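/-
Copyright (c) 2026 the pub-hodgecm-mathlib formalisation cell (harness21).  Prover seat hodgecm-mathlib-K2Liu-p03 (g9), Track B «K2-LIT» ∕ hLiu418 #184♮ =
`stmt-HodgeConjecture-24832`, socket #41 KIND 1, block K1-b♮ (dec-2-pay) F3 (`hFx′` road, per-place GLUE): «THE LINE'S LOCAL INTEGRAL OF A TRANSLATED LOCAL SIEGEL SECTION
`∫_{N_Δ(L⁺_v)} ψ(u) Φ(B_v((w_Δ)_v u)·g_v) dν(u)` CONVERGES ABSOLUTELY AND IS BOUNDED BY `B_Φ·(∏_{w∣v}(max(1,R_u) H_w(g))^n)^{e_Φ}` TIMES THE RANK-ONE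
GINDIKIN–KARPELEVICH MAJORANT».  THEOREMS ONLY (no `def`, no `instance`, no notation, no named-fact hypothesis, no `sorry`); lane `--supports stmt-HodgeConjecture-24832 --as helper`.
-/
import Summits.HodgeConjecture.HodgeConjecture.Theorems.K2LiuKindOneLineLocalAbsoluteMajorant   -- ★ p865210 F3-loc §2 `integrable_and_norm_integral_le`
import Summits.HodgeConjecture.HodgeConjecture.Theorems.K2LiuKindOneLineLocalPullbackSection    -- ★ p865439 (PB) `pullback_mem_localDegPS`
import Summits.HodgeConjecture.HodgeConjecture.Theorems.K2LiuKindOneLineLocalTranslateSize      -- ★ `norm_apply_cornerLoc_mul_evalPlace_le` (value letters from an entry-size letter)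
import Literature.NumberTheory.GelbartRogawski1991.DoubledWeilRepresentationArchLagrangian     -- ★ `isUnit_det_gramR₀`
import HarnessLib

/-!
# Crux `HLiu418`, socket #41, KIND 1 b♮ (dec-2-pay) F3 — `K2LiuKindOneLineLocalTranslateIntegral`: THE PER-PLACE MAJORANT OF THE LINE'S TRANSLATED LOCAL INTEGRAL

Cell `hodgecm-mathlib`, crux item hLiu418 = `stmt-HodgeConjecture-24832` (helper lane, count-neutral).  Namespace `…Cruxes.HLiu418.K2LiuKindOneLineLocalTranslateIntegral`.
WHY.  F2γ's `Ffin_def` writes the finite part of the K1-b♮ line's Whittaker coefficient at the translate `g = Λ₀(γ̂)·h` as a product over `v ∈ T′(σf, g)` of local integrals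
`∫_{N_Δ(L⁺_v)} conj ψ_{σf,v}(u) · Φ_{i,v}(B_v((w_Δ)_v·u)·g_v) dν_v(u)` (`Φ_{i,v} ∈ I^{(V)}_v(s, χ_v)` the line's local factor, ★ `exists_kindW_factorization` ∕ ★
`isFactorizableOff_cornerTranslate`; `B_v` the local corner chart ★ `K2LiuKindOneLineLocalPullback`).  The residual letter `hFx′` of ★ p865287 (typ2 v44 :375) is paid by ★ F3-asm
`hFfin_of_placeBounds` from a PER-PLACE letter `‖W i v s x‖ ≤ ((q_v^{c_v})·∏_{w∣v} H_w(g))^{M}·(1 + 2 q_v^{-(1+ε)})`.  THIS FILE is the per-place GLUE producing such a bound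
for ONE place from the landed bricks: ★ (PB) `pullback_mem_localDegPS` (`u ↦ Φ(B_v(u)·g_v)` is a smooth Siegel section of the LINE at `s + n₁∕2`), ★ F3-loc §2
`integrable_and_norm_integral_le` (absolute majorant of the rank-one line integral from the value letters `hnear ∕ hfar`), and ★ `K2LiuKindOneLineLocalTranslateSize` §3
(value letters from an ENTRY-SIZE letter of `Φ` and ENTRY letters of the coset representatives, ★ `K2LiuLocalWeylUnipotentEntrySize`):
* **`integrable_and_norm_integral_translate_le`** — for `Φ ∈ I^{(V)}_v(s, χ_v)` with entry-size letter `(B_Φ, e_Φ)`, `χ` unitary above `v`, `0 < re s + n₁∕2`, a continuous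
  weight `‖ψ‖ ≤ 1`, `g ∈ H(𝔸)`, and coset representatives with entries of norm `≤ R_u` above `v`:
  `Integrable (u ↦ ψ(u) Φ(B_v((w_Δ)_v u) g_v)) ν` and `‖∫ …‖ ≤ B_Φ (∏_w (max(1,R_u) H_w(g))^n)^{e_Φ} · max(1, c_δ^{re s + n₁∕2 + 1∕2}) · (ν∘coord⁻¹)(𝒪_v) · (1 − q_v^{−(2 re s + n₁)})⁻¹`.
References: [Casselman1980, §3]; [HarrisKudlaSweet1996, §1 (1.15), §6 (6.14)–(6.16)]; [Kudla1994, §2–§3]; [KudlaRallis1994, §2]; [BorelJacquet1979, §1.2, §4.1];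
[Shimura1997, §18.4 Prop. 18.14, §19.1–§19.2]; [Li1992, §3].
HONEST LABEL: HC_CM is proved only modulo the 7 printed citations (2 remaining named inputs: hLiu418 = stmt-HodgeConjecture-24832, h413 = stmt-HodgeConjecture-24833) until rung 0
closes; count-neutral helper (`--supports stmt-HodgeConjecture-24832 --as helper`).
-/

set_option autoImplicit false
set_option linter.dupNamespace false -- the mandated namespace repeats `HodgeConjecture.HodgeConjecture`

noncomputable section

open scoped Matrix
open NumberField IsDedekindDomain MeasureTheory
open Literature.NumberTheory.Automorphic Literature.NumberTheory.Automorphic.UnitaryGroup Literature.NumberTheory.GaloisRepresentations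
open Literature.NumberTheory.GelbartRogawski1991 Literature.NumberTheory.GelbartRogawski1991.GRConstruction
open Literature.NumberTheory.GelbartRogawski1991.UnitaryDualPair Literature.NumberTheory.GelbartRogawski1991.UnitaryDualPair.LocalSplitting
open Literature.NumberTheory.K2Lit Literature.NumberTheory.K2Lit.SiegelDoubled
open Summit.HodgeConjecture.HodgeConjecture.Cruxes.HLiu418.K2LiuUnipDeltaRankOneCoordinates (skew_coord)
open Summit.HodgeConjecture.HodgeConjecture.Cruxes.HLiu418.K2LiuKindOneLineLocalAbsoluteMajorant (integrable_and_norm_integral_le)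
open Summit.HodgeConjecture.HodgeConjecture.Cruxes.HLiu418.K2LiuKindOneLineLocalPullbackSection (pullback_mem_localDegPS)
open Summit.HodgeConjecture.HodgeConjecture.Cruxes.HLiu418.K2LiuKindOneLineLocalTranslateSize (norm_apply_cornerLoc_mul_evalPlace_le)

namespace Summit.HodgeConjecture.HodgeConjecture.Cruxes.HLiu418.K2LiuKindOneLineLocalTranslateIntegral

variable (L : Type) [Field L] [NumberField L] [IsCMField L]
variable {N₁ N₂ M n n₁ : ℕ} (eV : Fin (N₁ + N₂) × Fin M ≃ Fin n) (eA : Fin N₁ × Fin M ≃ Fin n₁) (eB : Fin N₂ × Fin M ≃ Fin 1)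
  (dA : Fin N₁ → L) (hdA : ∀ i, IsCMField.complexConj L (dA i) = dA i)
  (dB : Fin N₂ → L) (hdB : ∀ i, IsCMField.complexConj L (dB i) = dB i) (hdB0 : ∀ i, dB i ≠ 0)
  (dV : Fin (N₁ + N₂) → L) (hdV : ∀ i, IsCMField.complexConj L (dV i) = dV i)
  (hVA : ∀ i, dV (Fin.castAdd N₂ i) = dA i) (hVB : ∀ j, dV (Fin.natAdd N₁ j) = dB j)
  (dW : Fin M → L) (hdW : ∀ i, IsCMField.complexConj L (dW i) = dW i) (hdW0 : ∀ i, dW i ≠ 0)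
  (v : HeightOneSpectrum (𝓞 (Fp L)))

set_option maxHeartbeats 1600000 in -- ★ (PB) p865439's MEASURED class (the D10 ∕ K2Lit defeqs `locToAdelic = inclPlaceAdelic`, `hermD = (gramD …).map` behind ★ (PB) and ★ F3-loc meet here); GREEN at 1600000 (whole file 60 s on the farm), not minimised under the 04:19:50Z wind-down; scoped to this decl
/-- **THE PER-PLACE MAJORANT OF THE LINE'S TRANSLATED LOCAL INTEGRAL.**  Data: the K1-b♮ line `H^{(B)} = U(1,1)` inside `H^{(V)} = U(n,n)` (`n = n₁ + 1`, frames
`eV eA eB`, diagonal data `dA dB dV dW`, `dB, dW` non-vanishing); a finite place `v` of `L⁺`; the local Siegel unipotent `N′ = N_Δ(L⁺_v)` of the line with a Haar measure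
`ν`; a Hecke character `χ` unitary above `v`; `0 < re s + n₁∕2`; a smooth local Siegel section `Φ ∈ I^{(V)}_v(s, χ_v)` of the BIG group carrying an ENTRY-SIZE LETTER
`‖Φ g′‖ ≤ B_Φ (∏_w R_w^n)^{e_Φ}` (`B_Φ ≥ 0`; e.g. `Λ_{s,v}` with `(1, re s + n∕2)` by ★ `norm_lambdaLoc_le_of_entries`); a continuous weight `ψ` with `‖ψ‖ ≤ 1` (e.g.
`conj ψ_{β,v}`); a translate `g ∈ H^{(V)}(𝔸)`; and ENTRY letters `R_u` for the coset representatives `(w_Δ)_v n(ι_v b·δ)` (`‖b‖ ≤ 1`) and `(w_Δ)_v n(ι_v b′·δ) (w_Δ)_v`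
(`‖b′‖ ≤ ‖d⁻¹‖_v`, `d = δ²`, `δ = imagUnit L`) (★ `K2LiuLocalWeylUnipotentEntrySize`: `1` at a place where `2, δ` are units, a compactness constant elsewhere).
Conclusion: `u ↦ ψ(u)·Φ(B_v((w_Δ)_v·u)·g_v)` is `ν`-integrable on `N′` and
`‖∫_{N′} ψ(u) Φ(B_v((w_Δ)_v u) g_v) dν‖ ≤ B_Φ (∏_{w∣v} (max(1,R_u)·H_w(g))^n)^{e_Φ} · max(1, (∏_{w∣v}‖δ_w⁻¹‖)^{re s + n₁∕2 + 1∕2}) · (ν∘coord⁻¹)(𝒪_v) · (1 − q_v^{−2(re s + n₁∕2)})⁻¹`.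
Proof: `f := u ↦ Φ(B_v(u)·g_v)` is a smooth Siegel section of the line at `s + n₁∕2` (★ (PB) `pullback_mem_localDegPS`); its value letters at the coset representatives are
★ `norm_apply_cornerLoc_mul_evalPlace_le` on the entry letters; ★ F3-loc §2 `integrable_and_norm_integral_le` at `x := 1`.
[cite: Casselman1980, §3] [cite: HarrisKudlaSweet1996, §6 (6.14)–(6.16)] [cite: Kudla1994, §2–§3] [cite: KudlaRallis1994, §2] [cite: Shimura1997, §18.4 Prop. 18.14] -/
theorem integrable_and_norm_integral_translate_le [NeZero (n + n)] [Algebra.IsQuadraticExtension (Fp L) L]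
    [MeasurableSpace (v.adicCompletion (Fp L))] [BorelSpace (v.adicCompletion (Fp L))]
    {N' : Subgroup (UnitaryGroup.localPi L (IsCMField.complexConj L) (1 + 1) (hermD L eB dB hdB dW hdW) v)}
    (hN' : N' = LocalSiegelDoubled.unipDeltaLocal (Fp L) L (IsCMField.complexConj L) v 1 (JD := hermD L eB dB hdB dW hdW))
    [MeasurableSpace ↥N'] [BorelSpace ↥N'] (νN : Measure ↥N') [νN.IsHaarMeasure]
    {χ : HeckeCharacter L} (hχu : ∀ (w : UnitaryGroup.PlacesOver L v) (u : (w.1.adicCompletion L)ˣ), ‖((χ.localComponent w.1 u : ℂˣ) : ℂ)‖ = 1)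
    {s : ℂ} (hs : 0 < (s + (n₁ : ℂ) / 2).re)
    {Φ : UnitaryGroup.localPi L (IsCMField.complexConj L) (n + n) (hermD L eV dV hdV dW hdW) v → ℂ}
    (hΦ : Φ ∈ LocalSiegelDoubled.localDegPS (Fp L) L (IsCMField.complexConj L) (complexConj_imagUnit L) (imagUnit_ne_zero L) (imagUnit_mul_self L)
      v n (gramR_isSymm L eV dV hdV dW hdW) (hermD_eq_map_gramD L eV dV hdV dW hdW) (fun w => χ.localComponent w.1) s)
    {BΦ eΦ : ℝ} (hBΦ : 0 ≤ BΦ)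
    (hΦR : ∀ (g' : UnitaryGroup.localPi L (IsCMField.complexConj L) (n + n) (hermD L eV dV hdV dW hdW) v) (R : UnitaryGroup.PlacesOver L v → ℝ), (∀ w, 1 ≤ R w) →
      (∀ (w : UnitaryGroup.PlacesOver L v) (a b : Fin (n + n)),
        ‖(((g' : UnitaryGroup.LocalGLPi L (n + n) v) w : GL (Fin (n + n)) (w.1.adicCompletion L)) : Matrix (Fin (n + n)) (Fin (n + n)) (w.1.adicCompletion L)) a b‖ ≤ R w) →
      ‖Φ g'‖ ≤ BΦ * (∏ w : UnitaryGroup.PlacesOver L v, R w ^ n) ^ eΦ)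
    (ψ : UnitaryGroup.localPi L (IsCMField.complexConj L) (1 + 1) (hermD L eB dB hdB dW hdW) v → ℂ) (hψc : Continuous ψ) (hψ1 : ∀ u, ‖ψ u‖ ≤ 1)
    (g : HA L eV dV hdV dW hdW) {Ru : ℝ}
    (hRnear : ∀ b : v.adicCompletion (Fp L), ‖b‖ ≤ 1 → ∀ (w : UnitaryGroup.PlacesOver L v) (a b' : Fin (1 + 1)),
      ‖((((LocalSplitting.weylDelta (Fp L) L (IsCMField.complexConj L) v 1 (hermD_eq_map_gramD L eB dB hdB dW hdW) *
          LocalSplitting.nElem (Fp L) L (IsCMField.complexConj L) v 1 (hermD_eq_map_gramD L eB dB hdB dW hdW)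
            (Matrix.of fun _ _ : Fin 1 => toLocalRing L v b * algebraMap L (LocalRing L v) (imagUnit L))
            (skew_coord (Fp L) L (IsCMField.complexConj L) (complexConj_imagUnit L) v (isUnit_det_gramR₀ L eB dB hdB hdB0 dW hdW hdW0) b) :
        UnitaryGroup.localPi L (IsCMField.complexConj L) (1 + 1) (hermD L eB dB hdB dW hdW) v) : UnitaryGroup.LocalGLPi L (1 + 1) v) w : GL (Fin (1 + 1)) (w.1.adicCompletion L)) :
        Matrix (Fin (1 + 1)) (Fin (1 + 1)) (w.1.adicCompletion L)) a b'‖ ≤ Ru)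
    (hRfar : ∀ b : v.adicCompletion (Fp L), ‖b‖ ≤ ‖(((imagUnitSq L)⁻¹ : Fp L) : v.adicCompletion (Fp L))‖ → ∀ (w : UnitaryGroup.PlacesOver L v) (a b' : Fin (1 + 1)),
      ‖((((LocalSplitting.weylDelta (Fp L) L (IsCMField.complexConj L) v 1 (hermD_eq_map_gramD L eB dB hdB dW hdW) *
          LocalSplitting.nElem (Fp L) L (IsCMField.complexConj L) v 1 (hermD_eq_map_gramD L eB dB hdB dW hdW)
            (Matrix.of fun _ _ : Fin 1 => toLocalRing L v b * algebraMap L (LocalRing L v) (imagUnit L))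
            (skew_coord (Fp L) L (IsCMField.complexConj L) (complexConj_imagUnit L) v (isUnit_det_gramR₀ L eB dB hdB hdB0 dW hdW hdW0) b) *
          LocalSplitting.weylDelta (Fp L) L (IsCMField.complexConj L) v 1 (hermD_eq_map_gramD L eB dB hdB dW hdW) :
        UnitaryGroup.localPi L (IsCMField.complexConj L) (1 + 1) (hermD L eB dB hdB dW hdW) v) : UnitaryGroup.LocalGLPi L (1 + 1) v) w : GL (Fin (1 + 1)) (w.1.adicCompletion L)) :
        Matrix (Fin (1 + 1)) (Fin (1 + 1)) (w.1.adicCompletion L)) a b'‖ ≤ Ru) :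
    Integrable (fun u : ↥N' => ψ (u : UnitaryGroup.localPi L (IsCMField.complexConj L) (1 + 1) (hermD L eB dB hdB dW hdW) v) *
        Φ (UnitaryGroup.evalPlace (Fp L) L (IsCMField.complexConj L) (n + n) (hermD L eV dV hdV dW hdW) v (UnitaryGroup.finPart (Fp L) L (IsCMField.complexConj L) (n + n) (hermD L eV dV hdV dW hdW)
            (blkD L eV eA eB dA hdA dB hdB dV hdV hVA hVB dW hdW (1, locToAdelic L eB dB hdB dW hdW v
              (LocalSplitting.weylDelta (Fp L) L (IsCMField.complexConj L) v 1 (hermD_eq_map_gramD L eB dB hdB dW hdW) * (u : UnitaryGroup.localPi L (IsCMField.complexConj L) (1 + 1) (hermD L eB dB hdB dW hdW) v))))) *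
          UnitaryGroup.evalPlace (Fp L) L (IsCMField.complexConj L) (n + n) (hermD L eV dV hdV dW hdW) v (UnitaryGroup.finPart (Fp L) L (IsCMField.complexConj L) (n + n) (hermD L eV dV hdV dW hdW) g))) νN ∧
      ‖∫ u : ↥N', ψ (u : UnitaryGroup.localPi L (IsCMField.complexConj L) (1 + 1) (hermD L eB dB hdB dW hdW) v) *
        Φ (UnitaryGroup.evalPlace (Fp L) L (IsCMField.complexConj L) (n + n) (hermD L eV dV hdV dW hdW) v (UnitaryGroup.finPart (Fp L) L (IsCMField.complexConj L) (n + n) (hermD L eV dV hdV dW hdW)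
            (blkD L eV eA eB dA hdA dB hdB dV hdV hVA hVB dW hdW (1, locToAdelic L eB dB hdB dW hdW v
              (LocalSplitting.weylDelta (Fp L) L (IsCMField.complexConj L) v 1 (hermD_eq_map_gramD L eB dB hdB dW hdW) * (u : UnitaryGroup.localPi L (IsCMField.complexConj L) (1 + 1) (hermD L eB dB hdB dW hdW) v))))) *
          UnitaryGroup.evalPlace (Fp L) L (IsCMField.complexConj L) (n + n) (hermD L eV dV hdV dW hdW) v (UnitaryGroup.finPart (Fp L) L (IsCMField.complexConj L) (n + n) (hermD L eV dV hdV dW hdW) g)) ∂νN‖ ≤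
        BΦ * (∏ w : UnitaryGroup.PlacesOver L v, (max 1 Ru * (GLn.localHeight (n + n) L w.1 (g : GL (Fin (n + n)) (AdeleRing (𝓞 L) L)) : ℝ)) ^ n) ^ eΦ *
          max 1 ((∏ w : UnitaryGroup.PlacesOver L v, ‖(((imagUnit L)⁻¹ : L) : w.1.adicCompletion L)‖) ^ ((s + (n₁ : ℂ) / 2).re + 1 / 2)) *
          (Measure.map (fun u : ↥N' =>
              ((quadraticLocalEquiv L v (IsCMField.complexConj L) (complexConj_imagUnit L) (imagUnit_ne_zero L)).symm
                (AdaptedBlocks.blkB (LocalSplitting.matA (Fp L) L (IsCMField.complexConj L) v 1 (u : UnitaryGroup.localPi L (IsCMField.complexConj L) (1 + 1) (hermD L eB dB hdB dW hdW) v)) 0 0)).2) νN).real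
            (primePowBall (v.adicCompletion (Fp L)) 0) * (1 - (v.residueCard : ℝ) ^ (-(2 * (s + (n₁ : ℂ) / 2).re)))⁻¹ := by
  -- the pulled-back section of the LINE at `s + n₁∕2` (★ (PB))
  have hf := pullback_mem_localDegPS L eV eA eB dA hdA dB hdB dV hdV hVA hVB dW hdW v χ s hΦ
    (UnitaryGroup.evalPlace (Fp L) L (IsCMField.complexConj L) (n + n) (hermD L eV dV hdV dW hdW) v (UnitaryGroup.finPart (Fp L) L (IsCMField.complexConj L) (n + n) (hermD L eV dV hdV dW hdW) g))
  -- the value letters at the coset representatives (★ TranslateSize §3 on the entry letters)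
  have hB0 : 0 ≤ BΦ * (∏ w : UnitaryGroup.PlacesOver L v, (max 1 Ru * (GLn.localHeight (n + n) L w.1 (g : GL (Fin (n + n)) (AdeleRing (𝓞 L) L)) : ℝ)) ^ n) ^ eΦ :=
    mul_nonneg hBΦ (Real.rpow_nonneg (Finset.prod_nonneg fun w _ => pow_nonneg (mul_nonneg (zero_le_one.trans (le_max_left _ _)) NNReal.zero_le_coe) _) _)
  have h := integrable_and_norm_integral_le (Fp L) L (IsCMField.complexConj L) (complexConj_imagUnit L) (imagUnit_ne_zero L) (imagUnit_mul_self L) v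
    (isUnit_det_gramR₀ L eB dB hdB hdB0 dW hdW hdW0) (hermD_eq_map_gramD L eB dB hdB dW hdW) (gramR_isSymm L eB dB hdB dW hdW) hN' νN hχu hs hf.1 hf.2 ψ hψc hψ1 1 hB0
    (fun b hb => norm_apply_cornerLoc_mul_evalPlace_le L eV eA eB dA hdA dB hdB dV hdV hVA hVB dW hdW v hΦR _ (fun w a b' => by rw [mul_one]; exact hRnear b hb w a b') g)
    (fun b hb => norm_apply_cornerLoc_mul_evalPlace_le L eV eA eB dA hdA dB hdB dV hdV hVA hVB dW hdW v hΦR _ (fun w a b' => by rw [mul_one]; exact hRfar b hb w a b') g)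
  simp only [mul_one] at h
  exact h

end Summit.HodgeConjecture.HodgeConjecture.Cruxes.HLiu418.K2LiuKindOneLineLocalTranslateIntegral

end
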